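/-
Origin: expansion seat `planner-pub-hodgecm-pv02-g3-0`, handover #8 2026-08-18T06:13:24Z (`HOME/pub-hodgecm-pv02-g3/lean/Pv02g3/PerL34/S1StrengthCRDelta.lean`, md5 e35cf525, 71 lines);
landed by the gen-6 packager in gate run 24 as `HodgeCM/PerL34/S1StrengthCRDelta.lean` (import ^import Pv[0-9]+g[0-9]+\.PerL34\.→import HodgeCM.PerL34. ×1; stripped 1 #print/#check/#eval lines).
-/
/-
Origin: planner-pub-hodgecm-pv02-g3-0 (unit pub-hodgecm-pv02-g3, DAG-NODE PROVER #02 gen 3), 2026-08-18.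
Proposed tree path: `HodgeCM/PerL34/S1StrengthCRDelta.lean` (new, additive).  Imports my `S1StrengthCR` (run-24 queue)
and pv03-g2's LANDED `HodgeCM.PerL34.CharSpansFinal` (run 23).  KERNEL: nothing cited, nothing asserted.
-/
import Summits.HodgeConjecture.HodgeCM.PerL34.S1StrengthCR_2
import Summits.HodgeConjecture.HodgeCM.PerL34.CharSpansFinal

/-!
# Strength test of the FINAL-FORM binder `CharSpansFinal.WeilStepsInputCRΔ T` (pv03-g2's request, GAPS pv03g2-P1
addendum 06:10:28Z)

`WeilStepsInputCRΔ T` replaces `Dense Δ` by the DEFINITIONAL identification `Γ = ((toU21 V Tfr hT).prod ψ).range` of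
the lattice with the image of `G_U(L₀)` under a frame.  The junk package of `S1StrengthCR` is stable under ALL of
`U(2,1)`, so it serves over any subgroup of the diagonal; taking `Γ :=` the image of `γ ↦ (toU21 γ, (), toU21 γ)`
(`ψ := (1, toU21 V Tfr hT)`, a frame from pv01-g2's `RealApproximation.exists_frame`) gives the same verdict:

  `weilStepsInputCRΔ_iff (C : SplitHolConfig) (hch : T.Open_chars) :`
  `  WeilStepsInputCRΔ T ↔ Open_thetaWedgeHereditary T ∧ CharsNonempty T`.

So the final-form binder carries no `T`-dependent content beyond hereditary A6 either (modulo the `T`-free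
`SplitHolConfig`, cf. `SplitHolForms.OrbitSpansDisjoint`).
-/

noncomputable section

namespace HodgeCM
namespace PerL34
namespace S1StrengthCR

open HodgeCM.PerL34.BallModel HodgeCM.PerL34.CharSpans HodgeCM.PerL34.CharSpansWeil HodgeCM.PerL34.CharSpansCR
  HodgeCM.PerL34.CharSpansFinal HodgeCM.PerL34.RealApproximation HodgeCM.PerL34.StepsVacuity
open Literature.AlgebraicGeometry.ShimuraVarieties (unitaryGroup conjRingHomK)

variable {U : Universe} (T : U.ThetaModel)

/-- **Upper bound for the final-form binder**: over any `SplitHolConfig`, hereditary A6 and non-empty character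
sets give `WeilStepsInputCRΔ T`, by the junk package over the image of `G_U(L₀)` in the diagonal. -/
theorem weilStepsInputCRΔ_of_hereditary (C : SplitHolConfig) (hX : CharsNonempty T)
    (h : Open_thetaWedgeHereditary T) : WeilStepsInputCRΔ T := by
  intro L ι₁ V c hc
  obtain ⟨Γ₀, hC⟩ := h V c hc
  haveI : Nonempty (T.t12 V c).X := hX V c hc
  obtain ⟨Tfr, hT⟩ := exists_frame V
  let ψ : unitaryGroup (conjRingHomK L) V.Hm →* Unit × U21 := (1 : _ →* Unit).prod (toU21 V Tfr hT)
  let Γg : Subgroup (U21 × Unit × U21) := ((toU21 V Tfr hT).prod ψ).range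
  have hΓg : Γg ≤ Junk.Γd := by
    rintro _ ⟨γ, rfl⟩
    exact ⟨toU21 V Tfr hT γ, rfl⟩
  exact ⟨Junk.M C hC Γg, ⟨Junk.pkg C hC Γg hΓg⟩, ⟨Tfr, hT, ψ, rfl⟩, Junk.dict₀ C hC Γg, Junk.dict₁ C hC Γg,
    Junk.dict_cup C hC Γg⟩

/-- **P1, S1 half, the final-form binder**: over any `SplitHolConfig` and given node N31,
`WeilStepsInputCRΔ T ↔ hereditary A6 ∧ non-empty character sets`. -/
theorem weilStepsInputCRΔ_iff (C : SplitHolConfig) (hch : T.Open_chars) :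
    WeilStepsInputCRΔ T ↔ Open_thetaWedgeHereditary T ∧ CharsNonempty T :=
  ⟨fun h => (weilStepsInputCR_iff T C hch).1 (weilStepsInputCR_of_CRΔ T h),
    fun h => weilStepsInputCRΔ_of_hereditary T C h.2 h.1⟩

/-- Hence all four binders of the S1 chain are equivalent over any `SplitHolConfig`. -/
theorem weilStepsInputCRΔ_iff_CR (C : SplitHolConfig) (hch : T.Open_chars) :
    WeilStepsInputCRΔ T ↔ WeilStepsInputCR T :=
  (weilStepsInputCRΔ_iff T C hch).trans (weilStepsInputCR_iff T C hch).symm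

end S1StrengthCR
end PerL34
end HodgeCM

end

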